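import Literature.NumberTheory.GaloisRepresentations.PstCrystallineExtensionData
import Literature.NumberTheory.GaloisRepresentations.PotentialDiagonalizabilityFontaineLaffaille
import HarnessLib

/-!
# The Fontaine–Laffaille-type range facts over the summit's `p`-adic Hodge datum, degree-one base

Companion (theorem-only) of `PstCrystallineExtensionData.lean`, whose API turns BLGGT Lemma 1.4.3 (1)
into PD statements over the summit's datum (`isPotentiallyDiagonalizable_of_hasInvariantCompleteFlag`).
This file does the same for the RANGE facts — BLGGT Lemma 1.4.3 (2) (the tree's named fact
`blggt2014_lemma_1_4_3_2`, interval length `p − 2`) and any fact of the same shape with another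
length `m` (Gao–Liu 2014 Thm. 3.0.3: `m = p − 1`) — over a base field `K` of DEGREE ONE, i.e. when
the datum's structure map `ℚ_p → K` is onto (`K = ℚ_p`: a place `v ∣ p` of residue degree and
ramification `1`, e.g. `p` split in a quadratic field).  Wanted by stub `stub_pdAtSplitPrime` of
crux `stmt-Langlands-17000` (`NonParallelVoid.TwistedInductionParallel`) and by the `f = 1` slice of
`PD2Unram` (`stmt-Langlands-14643`).

The point is bookkeeping between the two weight vocabularies.  The range facts read labelled
weights off the crystalline datum `𝔈.𝔅 ⊥` at labels `τ' : F₀ →+* ℚ̄_p` of its invariant field,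
while the summit reads them off `𝔇.𝔅` (intended `B_dR`) at `ℚ_p`-algebra embeddings
`τ : K →ₐ[ℚ_p] ℚ̄_p`.  Over a degree-one base: `F₀ = ⊤` (`intermediateField_eq_top_of_surjective`),
so every `τ'` is a base label `CrystallineExtensionData.baseLabel 𝔈.𝔅 τ` of a ring homomorphism
`τ : K →+* ℚ̄_p` (`exists_baseLabel_eq_of_surjective`) and the interface axiom
`labelledHodgeTateWeights_bot_eq` identifies the two multisets; a `τ` which is NOT `ℚ_p`-linear has
`D_τ = 0` and carries NO weights (`PeriodRingData.labelledHodgeTateWeights_eq_zero_of_not_commutes`),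
so only the `ℚ_p`-algebra embeddings matter; and `K/ℚ_p` is then finite and `IsAbsolutelyUnramified`.

## Main statements (all proved)

* `PeriodRingData.baseAct_algebraMap`, `PeriodRingData.labelD_eq_bot_of_not_commutes`,
  `PeriodRingData.labelledHodgeTateWeights_eq_zero_of_not_commutes` — labels incompatible with the
  coefficient field `P` carry no Hodge–Tate weights (the remark "for a `τ` not compatible with `P`
  one gets `labelD = 0` and `HT_τ = 0`" of `LabelledHodgeTateWeights.lean`, now a theorem).
* `isAbsolutelyUnramified_of_surjective`, `intermediateField_eq_top_of_surjective`,
  `CrystallineExtensionData.exists_baseLabel_eq_of_surjective`.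
* `PstCrystallineExtensionData.isPotentiallyDiagonalizable_of_weightsInRange_of_surjective` — for
  `ℚ_p → K` onto and a length-`m` range fact at `p` (hypothesis `hfact`, the shape of
  `blggt2014_lemma_1_4_3_2 p`), every `𝔇`-crystalline `ρ : Γ_K → GL_n(ℚ̄_p)` whose `𝔇.𝔅`-weights lie in
  an interval of length `m` at every `ℚ_p`-embedding is potentially diagonalizable relative to `𝔈.𝔅`,
  for EVERY `𝔈`;
* `PstCrystallineExtensionData.isPotentiallyDiagonalizable_of_flRange_of_surjective` — the case
  `m = p − 2` from the named fact `blggt2014_lemma_1_4_3_2`.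

## References

* T. Barnet-Lamb, T. Gee, D. Geraghty, R. Taylor, *Potential automorphy and change of weight*,
  Ann. of Math. 179 (2014), §1.4 Lemma 1.4.3 (2) (arXiv:1010.2561 p. 15). [BarnetlambEtAl2014]
* H. Gao, T. Liu, *A note on potential diagonalizability of crystalline representations*, Math. Ann.
  360 (2014), Thm. 3.0.3. [GaoLiu2014]
* S. Patrikis, *Variations on a theorem of Tate*, Mem. AMS 258 (2019), §2.3.1 (`τ`-components).
  [Patrikis2019]
-/

noncomputable section

open Field
open scoped TensorProduct

namespace Literature.NumberTheory.GaloisRepresentations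

/-! ### Labels incompatible with the coefficient field carry no weights -/

/-- A function without jumps has empty jump multiset (also proved, in a `Negative` theorem file of
crux `CrystallineProModularClassical`, outside the cone; kept private here). [folklore] -/
private theorem jumpMultiset_eq_zero_of_forall_eq' {d : ℤ → ℕ} (h : ∀ i, d (i + 1) = d i) :
    jumpMultiset d = 0 := by
  have hf : {i : ℤ | d (i + 1) < d i} = ∅ := Set.eq_empty_of_forall_notMem fun i hi => by
    simp only [Set.mem_setOf_eq, h i, lt_self_iff_false] at hi
  rw [jumpMultiset_of_finite (by rw [hf]; exact Set.finite_empty)]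
  refine Finset.sum_eq_zero fun i _ => ?_
  rw [h i, Nat.sub_self, Multiset.replicate_zero]

namespace PeriodRingData

section Labels

universe u v v' w

variable {Γ : Type u} [Group Γ] {P : Type v} {K : Type v'} [Field P] [Field K] [Algebra P K]
  {E : Type*} [Field E] [Algebra P E]
  {M : Type*} [AddCommGroup M] [Module E M] [Module P M] [IsScalarTower P E M]
  (𝔅 : PeriodRingData.{u, v, v', w} Γ P K)

/-- The scalars `P` act on `M ⊗_P B` through `B` as they do through `M`: for `c : P`,
`id ⊗ (algebraMap P K c • ·)` is multiplication by `algebraMap P E c`. [folklore] -/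
theorem baseAct_algebraMap (c : P) (x : M ⊗[P] 𝔅.B) :
    𝔅.baseAct E M (algebraMap P K c) x = algebraMap P E c • x := by
  induction x using TensorProduct.induction_on with
  | zero => simp
  | tmul m b =>
    rw [PeriodRingData.baseAct_tmul, algebraMap_smul, algebraMap_smul, TensorProduct.tmul_smul]
  | add x y hx hy => rw [map_add, hx, hy, smul_add]

variable [TopologicalSpace Γ] [TopologicalSpace E] [TopologicalSpace M] (r : ContinuousRep Γ E M)

/-- **A label `τ : K →+* E` which is not `P`-linear has `D_τ = 0`**: on `D_τ` every `f ∈ K` acts as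
`τ f`, while `algebraMap P K c` acts as `c` (Patrikis §2.3.1: only the factors of `K ⊗_P E` through
which `τ ⊗ id` factors contribute). [cite: Patrikis2019, §2.3.1] -/
theorem labelD_eq_bot_of_not_commutes (τ : K →+* E) {c : P}
    (hc : τ (algebraMap P K c) ≠ algebraMap P E c) : 𝔅.labelD r τ = ⊥ := by
  refine (Submodule.eq_bot_iff _).2 fun x hx => ?_
  have h1 := ((𝔅.mem_labelD_iff r τ x).1 hx).2 (algebraMap P K c)
  rw [baseAct_algebraMap] at h1
  have h2 : (τ (algebraMap P K c) - algebraMap P E c) • x = 0 := by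
    rw [sub_smul, ← h1, sub_self]
  rcases smul_eq_zero.1 h2 with h | h
  · exact absurd (sub_eq_zero.1 h) hc
  · exact h

/-- … hence **`HT_τ(r) = ∅`** (the empty multiset) at a label not compatible with `P`.
[cite: Patrikis2019, §2.3.1] -/
theorem labelledHodgeTateWeights_eq_zero_of_not_commutes (τ : K →+* E) {c : P}
    (hc : τ (algebraMap P K c) ≠ algebraMap P E c) :
    𝔅.labelledHodgeTateWeights r τ = 0 := by
  have hD : ∀ i, 𝔅.labelFilD r τ i = ⊥ := fun i =>
    eq_bot_iff.2 ((𝔅.labelFilD_le r τ i).trans (𝔅.labelD_eq_bot_of_not_commutes r τ hc).le)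
  rw [PeriodRingData.labelledHodgeTateWeights_def]
  exact jumpMultiset_eq_zero_of_forall_eq' fun i => by rw [hD, hD]

end Labels

end PeriodRingData

/-! ### A base of degree one: `ℚ_p → K` onto -/

section Onto

variable {p : ℕ} [Fact p.Prime] {K : Type} [Field K] [Algebra ℚ_[p] K]

/-- `ℚ_p → K` onto ⇒ `K/ℚ_p` unramified in the sense `IsAbsolutelyUnramified` (`K = ℚ_p(1)`).
[folklore] -/
theorem isAbsolutelyUnramified_of_surjective
    (hs : Function.Surjective (algebraMap ℚ_[p] K)) : IsAbsolutelyUnramified p K := by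
  refine ⟨1, 1, one_pos, fun h => (Fact.out : p.Prime).one_lt.ne' (Nat.dvd_one.1 h), one_pow 1, ?_⟩
  exact Algebra.eq_top_iff.2 fun x => by
    obtain ⟨c, rfl⟩ := hs x
    exact Subalgebra.algebraMap_mem _ c

/-- `ℚ_p → K` onto ⇒ `K/ℚ_p` finite. [folklore] -/
theorem finiteDimensional_of_surjective_algebraMap (hs : Function.Surjective (algebraMap ℚ_[p] K)) :
    FiniteDimensional ℚ_[p] K :=
  Module.Finite.of_surjective (Algebra.linearMap ℚ_[p] K) hs

/-- `ℚ_p → K` onto ⇒ every intermediate field of `⊥ ≃ K` over `ℚ_p` — in particular the invariant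
field `F₀` of a crystalline datum at the base field — is everything. [folklore] -/
theorem intermediateField_eq_top_of_surjective (hs : Function.Surjective (algebraMap ℚ_[p] K))
    (F₀ : IntermediateField ℚ_[p] (⊥ : IntermediateField K (AlgebraicClosure K))) : F₀ = ⊤ := by
  refine eq_top_iff.2 fun x _ => ?_
  obtain ⟨k, hk⟩ := IntermediateField.mem_bot.1 x.2
  obtain ⟨c, rfl⟩ := hs k
  have hx : x = algebraMap ℚ_[p] (⊥ : IntermediateField K (AlgebraicClosure K)) c := by
    apply Subtype.ext
    change (x : AlgebraicClosure K) = algebraMap ℚ_[p] (AlgebraicClosure K) c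
    rw [← hk, IsScalarTower.algebraMap_apply ℚ_[p] K (AlgebraicClosure K) c]
  rw [hx]
  exact IntermediateField.algebraMap_mem F₀ c

/-- `ℚ_p → K` onto ⇒ every label of the invariant field `F₀` of the base crystalline datum is the
base label `CrystallineExtensionData.baseLabel 𝔅 τ` of a label `τ : K →+* ℚ̄_p` of `K`
(`F₀ = ⊤ ≃ ⊥ ≃ K`). [folklore] -/
theorem CrystallineExtensionData.exists_baseLabel_eq_of_surjective
    (hs : Function.Surjective (algebraMap ℚ_[p] K)) (𝔅 : CrystallineExtensionData.{0, 0} p K)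
    (τ' : (𝔅 ⊥ inferInstance).F₀ →+* PadicAlgCl p) :
    ∃ τ : K →+* PadicAlgCl p, CrystallineExtensionData.baseLabel 𝔅 τ = τ' := by
  have hF₀ : (𝔅 ⊥ inferInstance).F₀ = ⊤ := intermediateField_eq_top_of_surjective hs _
  set j : (𝔅 ⊥ inferInstance).F₀ →+* K :=
    ((IntermediateField.botEquiv K (AlgebraicClosure K)).toAlgHom.toRingHom).comp
      (algebraMap ((𝔅 ⊥ inferInstance).F₀) (⊥ : IntermediateField K (AlgebraicClosure K))) with hj
  have hjb : Function.Bijective j := by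
    refine ⟨j.injective, fun k => ?_⟩
    have hmem : (IntermediateField.botEquiv K (AlgebraicClosure K)).symm k ∈ (𝔅 ⊥ inferInstance).F₀ := by
      rw [hF₀]; exact IntermediateField.mem_top
    refine ⟨⟨_, hmem⟩, ?_⟩
    simp [hj]
  let e : (𝔅 ⊥ inferInstance).F₀ ≃+* K := RingEquiv.ofBijective j hjb
  refine ⟨τ'.comp e.symm.toRingHom, RingHom.ext fun x => ?_⟩
  have hex : e x = j x := RingEquiv.ofBijective_apply j hjb x
  change τ' (e.symm (j x)) = τ' x
  rw [← hex, e.symm_apply_apply]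

end Onto

/-! ### The range facts over the summit's datum -/

namespace PstCrystallineExtensionData

variable {K : Type} [Field K] [ValuativeRel K] [TopologicalSpace K] [IsNonarchimedeanLocalField K]
  {p : ℕ} [Fact p.Prime] {𝔇 : PstWeilDeligneData K p} (𝔈 : PstCrystallineExtensionData 𝔇) {n : ℕ}

/-- **The length-`m` range fact over the summit's datum, degree-one base.**  Suppose the datum's
structure map `ℚ_p → K` is onto, and suppose the range fact of length `m` at `p` (`hfact`: every
crystalline representation of an absolutely unramified finite `K'/ℚ_p` whose labelled Hodge–Tate
weights lie, label by label, in an interval of length `m` is potentially diagonalizable — for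
`m = p − 2` this is `blggt2014_lemma_1_4_3_2 p`, for `m = p − 1` Gao–Liu's Thm. 3.0.3 at `p`).  Then
every `𝔇`-crystalline `ρ : Γ_K → GL_n(ℚ̄_p)` whose `𝔇.𝔅`-weights at every `ℚ_p`-embedding
`τ : K →ₐ[ℚ_p] ℚ̄_p` lie in an interval of length `m` is potentially diagonalizable relative to `𝔈.𝔅`,
for EVERY instance `𝔈`.  Proof: `K/ℚ_p` is finite and `IsAbsolutelyUnramified`; `ρ|_{Γ_⊥}` is
crystalline relative to `𝔈.𝔅 ⊥` (`isCrystallineFn_restrictField`); at a label `τ' = baseLabel τ` of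
`F₀ = ⊤` the `(𝔈.𝔅 ⊥)`-weights are the `𝔇.𝔅`-weights at `τ` (`labelledHodgeTateWeights_bot_eq`), in
range if `τ` is `ℚ_p`-linear and EMPTY otherwise. [cite: BarnetlambEtAl2014, §1.4 Lemma 1.4.3 (2)]
[cite: GaoLiu2014, Thm. 3.0.3] -/
theorem isPotentiallyDiagonalizable_of_weightsInRange_of_surjective
    (hs : letI := 𝔇.algebra; Function.Surjective (algebraMap ℚ_[p] K)) (m : ℕ)
    (hfact : ∀ (K' : Type) [Field K'] [Algebra ℚ_[p] K'] [FiniteDimensional ℚ_[p] K']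
      (𝔅 : CrystallineExtensionData.{0, 0} p K') (n : ℕ) (ρ : FramedGaloisRep K' (PadicAlgCl p) n),
      IsAbsolutelyUnramified p K' →
      IsCrystallineFn (𝔅 ⊥ inferInstance)
        (ρ.restrictField (⊥ : IntermediateField K' (AlgebraicClosure K'))).matrixFn →
      (∀ τ : (𝔅 ⊥ inferInstance).F₀ →+* PadicAlgCl p, ∃ a : ℤ,
        ∀ h ∈ (𝔅 ⊥ inferInstance).toPeriodRingData.labelledHodgeTateWeights
            (ρ.restrictField (⊥ : IntermediateField K' (AlgebraicClosure K'))).toGaloisRep τ,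
          a ≤ h ∧ h ≤ a + m) →
      IsPotentiallyDiagonalizable 𝔅 ρ)
    {ρ : FramedGaloisRep K (PadicAlgCl p) n} (hρ : 𝔇.IsCrystallineFramed ρ)
    (hHT : letI := 𝔇.algebra
      ∀ τ : K →ₐ[ℚ_[p]] PadicAlgCl p, ∃ a : ℤ,
        ∀ h ∈ 𝔇.𝔅.labelledHodgeTateWeights ρ.toGaloisRep τ.toRingHom, a ≤ h ∧ h ≤ a + m) :
    letI := 𝔇.algebra
    IsPotentiallyDiagonalizable 𝔈.𝔅 ρ := by
  letI := 𝔇.algebra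
  haveI : FiniteDimensional ℚ_[p] K := finiteDimensional_of_surjective_algebraMap hs
  have hunr : IsAbsolutelyUnramified p K := isAbsolutelyUnramified_of_surjective hs
  have hbot : IsCrystallineFn (𝔈.𝔅 ⊥ inferInstance)
      ((ρ.restrictField (⊥ : IntermediateField K (AlgebraicClosure K))).matrixFn) :=
    𝔈.isCrystallineFn_restrictField ρ ⊥ inferInstance hρ
  refine hfact K 𝔈.𝔅 n ρ hunr hbot fun τ' => ?_
  have hF₀ : (𝔈.𝔅 ⊥ inferInstance).F₀ = ⊤ := intermediateField_eq_top_of_surjective hs _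
  obtain ⟨τ, rfl⟩ := CrystallineExtensionData.exists_baseLabel_eq_of_surjective hs 𝔈.𝔅 τ'
  rw [𝔈.labelledHodgeTateWeights_bot_eq ρ τ hρ hF₀]
  by_cases hlin : ∀ c : ℚ_[p], τ (algebraMap ℚ_[p] K c) = algebraMap ℚ_[p] (PadicAlgCl p) c
  · exact hHT { toRingHom := τ, commutes' := hlin }
  · push Not at hlin
    obtain ⟨c, hc⟩ := hlin
    refine ⟨0, fun h hh => ?_⟩
    rw [𝔇.𝔅.labelledHodgeTateWeights_eq_zero_of_not_commutes ρ.toGaloisRep τ hc] at hh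
    exact absurd hh (Multiset.notMem_zero h)

/-- **BLGGT Lemma 1.4.3 (2) over the summit's datum, degree-one base**: if `ℚ_p → K` is onto for the
datum's structure, then under the named fact `blggt2014_lemma_1_4_3_2` every `𝔇`-crystalline
`ρ : Γ_K → GL_n(ℚ̄_p)` whose `𝔇.𝔅`-weights at the (unique) `ℚ_p`-embedding lie in an interval of
length `p − 2` is potentially diagonalizable relative to `𝔈.𝔅`, for every `𝔈`.
[cite: BarnetlambEtAl2014, §1.4 Lemma 1.4.3 (2)] -/
theorem isPotentiallyDiagonalizable_of_flRange_of_surjective (hFL : blggt2014_lemma_1_4_3_2.{0})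
    (hs : letI := 𝔇.algebra; Function.Surjective (algebraMap ℚ_[p] K))
    {ρ : FramedGaloisRep K (PadicAlgCl p) n} (hρ : 𝔇.IsCrystallineFramed ρ)
    (hHT : letI := 𝔇.algebra
      ∀ τ : K →ₐ[ℚ_[p]] PadicAlgCl p, ∃ a : ℤ,
        ∀ h ∈ 𝔇.𝔅.labelledHodgeTateWeights ρ.toGaloisRep τ.toRingHom,
          a ≤ h ∧ h ≤ a + (p - 2 : ℕ)) :
    letI := 𝔇.algebra
    IsPotentiallyDiagonalizable 𝔈.𝔅 ρ :=
  𝔈.isPotentiallyDiagonalizable_of_weightsInRange_of_surjective hs (p - 2)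
    (fun K' _ _ _ 𝔅 n r h1 h2 h3 => hFL p K' 𝔅 n r h1 h2 h3) hρ hHT

end PstCrystallineExtensionData

end Literature.NumberTheory.GaloisRepresentations

end
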